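import Mathlib
import Summits.Ventures.HodgeRepro2.Tier7.Line3.CompactGroupSurjIntegral

/-!
# Tier7/Line3/CentralCharacter — the central-character bookkeeping of the bi-torus orbital integral, as one
abstract kernel statement (seat t7-L1-p2, gen 3; the t7-lead's ROW U3, STATUS l. 15242)

LINE 3 (t7-plan-3), version (ii), memo v13 §2e–§2g: at every place the group is `G = Z · G⁰` (a central `Z`:
`U(1,1) = U(1) · SU(1,1)`, `U(2) = U(1) · SU(2)`, the finite places alike), both tori `T_A`, `T_B` contain `Z`, the
test function `f` transforms under `Z` by the inverse of the central character `ω`, and the torus characters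
`μ_A`, `μ_B` restrict to `ω` on `Z`; the bi-torus orbital integral over `T_A × T_B` then equals the one over
`T_A⁰ × T_B⁰` (`T_A⁰ = T_A ∩ G⁰`), uniformly in `γ` — the bookkeeping that the archimedean reduction
`U(1,1) → SU(1,1)` (ROW U1) and the finite places consume, and the `[a + p = 0]` factor of §2g (5) when the
characters do not match. THIS FILE proves it abstractly, Mathlib + t7-x1's `CompactGroupSurjIntegral` (the Haar
transfer along a continuous surjective homomorphism, `integral_comp_of_surjective_prob`, and ROW U1's abstract half
`integral_eq_integral_of_invariant` in SUBGROUP form — the Haar-transfer / factorisation rows are x1's, STATUS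
l. 15266 / l. 15291), with every group COMPACT and every Haar measure a PROBABILITY measure (so the factor `vol(Z)`
of the memo's normalisation is `1`; the memo's constant is absorbed in the normalisation of `dt`):

* `integral_eq_integral_mul`: for compact abelian `T` and continuous homomorphisms `ι_Z : Z →* T`, `ι_S : S →* T`
  from compact abelian groups that are jointly surjective (`∀ t, ∃ z s, t = ι_Z z * ι_S s`),
  `∫_T F = ∫_Z ∫_S F (ι_Z z * ι_S s)` for continuous `F` — x1's Haar transfer along `(z, s) ↦ ι_Z z * ι_S s`
  (the overlap `ι_Z(Z) ∩ ι_S(S)`, finite in the applications, is absorbed: no fundamental domain, no quotient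
  measure) + Fubini; the HOMOMORPHISM form is what the product `T_A × T_B` of the bi-torus integral needs;
* `integral_eq_of_forall_mul_left_eq` — the factorisation in homomorphism form (x1's
  `integral_eq_integral_of_invariant` for subgroups): if `F (ι_Z z * t) = F t` for all `z`, `t`, then
  `∫_T F dμ_T = ∫_S F (ι_S s) dμ_S`;
* **`integral_eq_zero_of_forall_mul_left_eq_mul`** — THE MISMATCH: if `F (z₀ * t) = c * F t` with `c ≠ 1`, then
  `∫_T F = 0` (left invariance only; no integrability needed);
* **`biTorusOrbital_eq`** — the bookkeeping itself: `G` a topological group, `ρ_A : T_A →* G`, `ρ_B : T_B →* G` the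
  tori, `ζ_A : Z_A →* T_A`, `ζ_B : Z_B →* T_B` the central parts (`ρ_A (ζ_A z)` and `ρ_B (ζ_B z)` central in `G`),
  `σ_A : S_A →* T_A`, `σ_B : S_B →* T_B` the `G⁰`-parts (jointly surjective with the central parts), `μ_A`, `μ_B`
  the characters, and `f` with `f (ρ_A (ζ_A z) * g) = (μ_A (ζ_A z))⁻¹ * f g`, `f (ρ_B (ζ_B z) * g) =
  (μ_B (ζ_B z))⁻¹ * f g` (the central character of `f` is the inverse of the characters' restriction): for EVERY `γ`,
  `∫_{T_A × T_B} f (ρ_A t_A * γ * ρ_B t_B) μ_A t_A μ_B t_B = ∫_{S_A × S_B} f (ρ_A (σ_A s_A) * γ * ρ_B (σ_B s_B))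
  μ_A (σ_A s_A) μ_B (σ_B s_B)`;
* **`biTorusOrbital_eq_zero`** — the mismatched case: if instead `f (ρ_A (ζ_A z₀) * g) = c * f g` with
  `c * μ_A (ζ_A z₀) ≠ 1`, the orbital integral vanishes identically in `γ`.

All compact groups here are assumed second countable (true of every torus `U(1)ⁿ` and of every compact metrisable
group) so that Mathlib's product σ-algebra is the Borel σ-algebra. Nothing here is about an adelic group, a period
or (N); the identification of the real `U(W_A)(F_v)`, its centre, its tori, its Haar measures, `f_v` and the
central character with these objects is the dictionary (in words). No sorry; axioms ⊆ {propext, Classical.choice,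
Quot.sound}.
-/

namespace Summit.Ventures.HodgeRepro2.Tier7.Line3.CentralCharacter

open MeasureTheory Measure
open scoped ENNReal

section Factorisation

variable {T : Type*} [CommGroup T] [TopologicalSpace T] [IsTopologicalGroup T] [CompactSpace T]
  [SecondCountableTopology T] [MeasurableSpace T] [BorelSpace T]
variable {Z : Type*} [CommGroup Z] [TopologicalSpace Z] [IsTopologicalGroup Z] [CompactSpace Z]
  [SecondCountableTopology Z] [MeasurableSpace Z] [BorelSpace Z]
variable {S : Type*} [CommGroup S] [TopologicalSpace S] [IsTopologicalGroup S] [CompactSpace S]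
  [SecondCountableTopology S] [MeasurableSpace S] [BorelSpace S]
variable (μT : Measure T) [μT.IsHaarMeasure] [IsProbabilityMeasure μT]
variable (μZ : Measure Z) [μZ.IsHaarMeasure] [IsProbabilityMeasure μZ]
variable (μS : Measure S) [μS.IsHaarMeasure] [IsProbabilityMeasure μS]

/-- the multiplication map `(z, s) ↦ ι_Z z * ι_S s` as a homomorphism `Z × S →* T`. -/
def mulHom (ιZ : Z →* T) (ιS : S →* T) : Z × S →* T := MonoidHom.coprod ιZ ιS

omit [TopologicalSpace T] [IsTopologicalGroup T] [CompactSpace T] [SecondCountableTopology T] [MeasurableSpace T]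
  [BorelSpace T] [TopologicalSpace Z] [IsTopologicalGroup Z] [CompactSpace Z] [SecondCountableTopology Z]
  [MeasurableSpace Z] [BorelSpace Z] [TopologicalSpace S] [IsTopologicalGroup S] [CompactSpace S]
  [SecondCountableTopology S] [MeasurableSpace S] [BorelSpace S] in
/-- `mulHom ιZ ιS (z, s) = ιZ z * ιS s`. -/
theorem mulHom_apply (ιZ : Z →* T) (ιS : S →* T) (p : Z × S) : mulHom ιZ ιS p = ιZ p.1 * ιS p.2 :=
  MonoidHom.coprod_apply ιZ ιS p

omit [CompactSpace T] [SecondCountableTopology T] [MeasurableSpace T] [BorelSpace T]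
  [IsTopologicalGroup Z] [CompactSpace Z] [SecondCountableTopology Z] [MeasurableSpace Z] [BorelSpace Z]
  [IsTopologicalGroup S] [CompactSpace S] [SecondCountableTopology S] [MeasurableSpace S] [BorelSpace S] in
/-- the multiplication map is continuous for continuous `ιZ`, `ιS`. -/
theorem continuous_mulHom {ιZ : Z →* T} {ιS : S →* T} (hZ : Continuous ιZ) (hS : Continuous ιS) :
    Continuous (mulHom ιZ ιS) := by
  have : (mulHom ιZ ιS : Z × S → T) = fun p => ιZ p.1 * ιS p.2 := funext (mulHom_apply ιZ ιS)
  rw [this]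
  exact (hZ.comp continuous_fst).mul (hS.comp continuous_snd)

omit [TopologicalSpace Z] [IsTopologicalGroup Z] [CompactSpace Z] [SecondCountableTopology Z] [MeasurableSpace Z]
  [BorelSpace Z] [TopologicalSpace S] [IsTopologicalGroup S] [CompactSpace S] [SecondCountableTopology S]
  [MeasurableSpace S] [BorelSpace S] [TopologicalSpace T] [IsTopologicalGroup T] [CompactSpace T]
  [SecondCountableTopology T] [MeasurableSpace T] [BorelSpace T] in
/-- the multiplication map is surjective when `ιZ`, `ιS` are jointly surjective. -/
theorem surjective_mulHom {ιZ : Z →* T} {ιS : S →* T} (hsurj : ∀ t : T, ∃ z s, t = ιZ z * ιS s) :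
    Function.Surjective (mulHom ιZ ιS) := by
  intro t
  obtain ⟨z, s, rfl⟩ := hsurj t
  exact ⟨(z, s), mulHom_apply ιZ ιS (z, s)⟩

omit [SecondCountableTopology T] [SecondCountableTopology Z] in
/-- **Fubini over the decomposition**: `∫_T F = ∫_Z ∫_S F (ιZ z * ιS s)` for continuous `F`. -/
theorem integral_eq_integral_mul {ιZ : Z →* T} {ιS : S →* T} (hZ : Continuous ιZ) (hS : Continuous ιS)
    (hsurj : ∀ t : T, ∃ z s, t = ιZ z * ιS s) {F : T → ℂ} (hF : Continuous F) :
    ∫ t, F t ∂μT = ∫ z, ∫ s, F (ιZ z * ιS s) ∂μS ∂μZ := by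
  haveI : BorelSpace (Z × S) := Prod.borelSpace
  rw [CompactGroupSurjIntegral.integral_comp_of_surjective_prob (μZ.prod μS) μT (mulHom ιZ ιS)
    (continuous_mulHom hZ hS) (surjective_mulHom hsurj) F hF]
  have hint : Integrable (fun p : Z × S => F (mulHom ιZ ιS p)) (μZ.prod μS) :=
    (hF.comp (continuous_mulHom hZ hS)).integrable_of_hasCompactSupport (HasCompactSupport.of_compactSpace _)
  rw [integral_prod _ hint]
  simp only [mulHom_apply]

omit [SecondCountableTopology T] [SecondCountableTopology Z] in
include μZ in
/-- **THE FACTORISATION**: a `Z`-invariant continuous integrand integrates over `S` alone,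
`∫_T F dμ_T = ∫_S F (ιS s) dμ_S`. -/
theorem integral_eq_of_forall_mul_left_eq {ιZ : Z →* T} {ιS : S →* T} (hZ : Continuous ιZ) (hS : Continuous ιS)
    (hsurj : ∀ t : T, ∃ z s, t = ιZ z * ιS s) {F : T → ℂ} (hF : Continuous F)
    (hinv : ∀ z t, F (ιZ z * t) = F t) : ∫ t, F t ∂μT = ∫ s, F (ιS s) ∂μS := by
  rw [integral_eq_integral_mul μT μZ μS hZ hS hsurj hF]
  simp only [hinv, integral_const, probReal_univ, one_smul]

omit [IsTopologicalGroup T] [CompactSpace T] [SecondCountableTopology T] [BorelSpace T] [IsProbabilityMeasure μT] in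
/-- **THE MISMATCH**: if `F (z₀ * t) = c * F t` for all `t` with `c ≠ 1`, then `∫_T F = 0` (left invariance of
`μ_T` only; no integrability or continuity is needed). -/
theorem integral_eq_zero_of_forall_mul_left_eq_mul [MeasurableMul T] (F : T → ℂ) (z₀ : T) (c : ℂ) (hc : c ≠ 1)
    (hF : ∀ t, F (z₀ * t) = c * F t) : ∫ t, F t ∂μT = 0 := by
  have h1 : ∫ t, F t ∂μT = c * ∫ t, F t ∂μT := by
    conv_lhs => rw [← integral_mul_left_eq_self F z₀]
    simp only [hF]
    exact integral_const_mul c F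
  have h2 : (1 - c) * ∫ t, F t ∂μT = 0 := by
    rw [sub_mul, one_mul, ← h1, sub_self]
  exact (mul_eq_zero.1 h2).resolve_left (sub_ne_zero.2 hc.symm)

end Factorisation

section BiTorus

variable {G : Type*} [Group G] [TopologicalSpace G] [IsTopologicalGroup G]
variable {TA : Type*} [CommGroup TA] [TopologicalSpace TA] [IsTopologicalGroup TA] [CompactSpace TA]
  [SecondCountableTopology TA] [MeasurableSpace TA] [BorelSpace TA]
variable {TB : Type*} [CommGroup TB] [TopologicalSpace TB] [IsTopologicalGroup TB] [CompactSpace TB]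
  [SecondCountableTopology TB] [MeasurableSpace TB] [BorelSpace TB]
variable {ZA : Type*} [CommGroup ZA] [TopologicalSpace ZA] [IsTopologicalGroup ZA] [CompactSpace ZA]
  [SecondCountableTopology ZA] [MeasurableSpace ZA] [BorelSpace ZA]
variable {ZB : Type*} [CommGroup ZB] [TopologicalSpace ZB] [IsTopologicalGroup ZB] [CompactSpace ZB]
  [SecondCountableTopology ZB] [MeasurableSpace ZB] [BorelSpace ZB]
variable {SA : Type*} [CommGroup SA] [TopologicalSpace SA] [IsTopologicalGroup SA] [CompactSpace SA]
  [SecondCountableTopology SA] [MeasurableSpace SA] [BorelSpace SA]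
variable {SB : Type*} [CommGroup SB] [TopologicalSpace SB] [IsTopologicalGroup SB] [CompactSpace SB]
  [SecondCountableTopology SB] [MeasurableSpace SB] [BorelSpace SB]
variable (μA : Measure TA) [μA.IsHaarMeasure] [IsProbabilityMeasure μA]
variable (μB : Measure TB) [μB.IsHaarMeasure] [IsProbabilityMeasure μB]
variable (μZA : Measure ZA) [μZA.IsHaarMeasure] [IsProbabilityMeasure μZA]
variable (μZB : Measure ZB) [μZB.IsHaarMeasure] [IsProbabilityMeasure μZB]
variable (μSA : Measure SA) [μSA.IsHaarMeasure] [IsProbabilityMeasure μSA]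
variable (μSB : Measure SB) [μSB.IsHaarMeasure] [IsProbabilityMeasure μSB]

/-- a character of a group into `ℂ` never vanishes. -/
theorem char_ne_zero {M : Type*} [Group M] (χ : M →* ℂ) (t : M) : χ t ≠ 0 := by
  intro h
  have h1 : χ t * χ t⁻¹ = 1 := by rw [← map_mul, mul_inv_cancel, map_one]
  rw [h, zero_mul] at h1
  exact zero_ne_one h1

omit [TopologicalSpace G] [IsTopologicalGroup G] [IsTopologicalGroup TA] [CompactSpace TA]
  [SecondCountableTopology TA] [BorelSpace TA] [IsTopologicalGroup TB] [CompactSpace TB] [SecondCountableTopology TB]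
  [BorelSpace TB] [μA.IsHaarMeasure] [IsProbabilityMeasure μA] [μB.IsHaarMeasure] [IsProbabilityMeasure μB] in
/-- **the bi-torus orbital integral** of `f` at `γ` against the characters `χA`, `χB`:
`∫_{T_A × T_B} f (ρA tA * γ * ρB tB) · χA tA · χB tB d(μA ⊗ μB)`. -/
noncomputable def biTorusOrbital (ρA : TA →* G) (ρB : TB →* G) (χA : TA →* ℂ) (χB : TB →* ℂ) (f : G → ℂ)
    (γ : G) : ℂ :=
  ∫ p : TA × TB, f (ρA p.1 * γ * ρB p.2) * χA p.1 * χB p.2 ∂(μA.prod μB)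

omit [TopologicalSpace G] [IsTopologicalGroup G] [TopologicalSpace TA] [IsTopologicalGroup TA] [CompactSpace TA]
  [SecondCountableTopology TA] [BorelSpace TA] [TopologicalSpace TB] [IsTopologicalGroup TB] [CompactSpace TB]
  [SecondCountableTopology TB] [BorelSpace TB] [μA.IsHaarMeasure] [IsProbabilityMeasure μA] [μB.IsHaarMeasure]
  [IsProbabilityMeasure μB] in
/-- the defining integral of `biTorusOrbital`. -/
theorem biTorusOrbital_def (ρA : TA →* G) (ρB : TB →* G) (χA : TA →* ℂ) (χB : TB →* ℂ) (f : G → ℂ) (γ : G) :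
    biTorusOrbital μA μB ρA ρB χA χB f γ =
      ∫ p : TA × TB, f (ρA p.1 * γ * ρB p.2) * χA p.1 * χB p.2 ∂(μA.prod μB) := rfl

omit [SecondCountableTopology TA] [SecondCountableTopology ZA] in
include μZA μZB in
/-- **THE CENTRAL-CHARACTER BOOKKEEPING** (ROW U3): with `T_A = ζA(Z_A) · σA(S_A)`, `T_B = ζB(Z_B) · σB(S_B)`, the
central parts `ρA (ζA z)`, `ρB (ζB z)` central in `G`, and `f` transforming under them by the inverse of the
characters (`f (ρA (ζA z) * g) = (χA (ζA z))⁻¹ * f g`, and likewise for `B`), the bi-torus orbital integral over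
`T_A × T_B` equals the one over `S_A × S_B` — for every `γ`. -/
theorem biTorusOrbital_eq (ρA : TA →* G) (ρB : TB →* G) (hρA : Continuous ρA) (hρB : Continuous ρB)
    (χA : TA →* ℂ) (χB : TB →* ℂ) (hχA : Continuous χA) (hχB : Continuous χB)
    (ζA : ZA →* TA) (σA : SA →* TA) (hζA : Continuous ζA) (hσA : Continuous σA)
    (hsurjA : ∀ t : TA, ∃ z s, t = ζA z * σA s)
    (ζB : ZB →* TB) (σB : SB →* TB) (hζB : Continuous ζB) (hσB : Continuous σB)
    (hsurjB : ∀ t : TB, ∃ z s, t = ζB z * σB s)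
    (f : G → ℂ) (hf : Continuous f)
    (hcB : ∀ z g, g * ρB (ζB z) = ρB (ζB z) * g)
    (hfA : ∀ z g, f (ρA (ζA z) * g) = (χA (ζA z))⁻¹ * f g)
    (hfB : ∀ z g, f (ρB (ζB z) * g) = (χB (ζB z))⁻¹ * f g) (γ : G) :
    biTorusOrbital μA μB ρA ρB χA χB f γ =
      ∫ q : SA × SB, f (ρA (σA q.1) * γ * ρB (σB q.2)) * χA (σA q.1) * χB (σB q.2) ∂(μSA.prod μSB) := by
  rw [biTorusOrbital_def]
  have hZ : Continuous (ζA.prodMap ζB) := by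
    rw [MonoidHom.coe_prodMap]
    exact hζA.prodMap hζB
  have hS : Continuous (σA.prodMap σB) := by
    rw [MonoidHom.coe_prodMap]
    exact hσA.prodMap hσB
  have hsurj : ∀ t : TA × TB, ∃ z s, t = (ζA.prodMap ζB) z * (σA.prodMap σB) s := by
    intro t
    obtain ⟨zA, sA, hA⟩ := hsurjA t.1
    obtain ⟨zB, sB, hB⟩ := hsurjB t.2
    exact ⟨(zA, zB), (sA, sB), Prod.ext hA hB⟩
  have hF : Continuous fun p : TA × TB => f (ρA p.1 * γ * ρB p.2) * χA p.1 * χB p.2 := by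
    refine ((hf.comp (((hρA.comp continuous_fst).mul continuous_const).mul (hρB.comp continuous_snd))).mul
      (hχA.comp continuous_fst)).mul (hχB.comp continuous_snd)
  have hinv : ∀ (z : ZA × ZB) (p : TA × TB),
      (fun p : TA × TB => f (ρA p.1 * γ * ρB p.2) * χA p.1 * χB p.2) ((ζA.prodMap ζB) z * p) =
        (fun p : TA × TB => f (ρA p.1 * γ * ρB p.2) * χA p.1 * χB p.2) p := by
    intro z p
    simp only [MonoidHom.coe_prodMap, Prod.map_fst, Prod.map_snd, Prod.fst_mul, Prod.snd_mul, map_mul]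
    have e : ρA (ζA z.1) * ρA p.1 * γ * (ρB (ζB z.2) * ρB p.2) =
        ρA (ζA z.1) * (ρB (ζB z.2) * (ρA p.1 * γ * ρB p.2)) := by
      have h1 : ρA p.1 * γ * ρB (ζB z.2) = ρB (ζB z.2) * (ρA p.1 * γ) := hcB z.2 (ρA p.1 * γ)
      calc ρA (ζA z.1) * ρA p.1 * γ * (ρB (ζB z.2) * ρB p.2)
          = ρA (ζA z.1) * (ρA p.1 * γ * ρB (ζB z.2)) * ρB p.2 := by simp only [mul_assoc]
        _ = ρA (ζA z.1) * (ρB (ζB z.2) * (ρA p.1 * γ)) * ρB p.2 := by rw [h1]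
        _ = ρA (ζA z.1) * (ρB (ζB z.2) * (ρA p.1 * γ * ρB p.2)) := by simp only [mul_assoc]
    rw [e, hfA, hfB]
    have hA0 := char_ne_zero χA (ζA z.1)
    have hB0 := char_ne_zero χB (ζB z.2)
    field_simp
  have h := integral_eq_of_forall_mul_left_eq (μA.prod μB) (μZA.prod μZB) (μSA.prod μSB) hZ hS hsurj hF hinv
  rw [h]
  simp only [MonoidHom.coe_prodMap, Prod.map_fst, Prod.map_snd]

omit [TopologicalSpace G] [IsTopologicalGroup G] [IsTopologicalGroup ZA] [CompactSpace ZA]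
  [SecondCountableTopology ZA] [MeasurableSpace ZA] [BorelSpace ZA] [TopologicalSpace ZA] [SecondCountableTopology TA]
  [IsProbabilityMeasure μA] [IsProbabilityMeasure μB] in
/-- **THE MISMATCH**: if the central character of `f` on the `A`-side central element `ρA (ζA z₀)` does not match
`χA` there (`f (ρA (ζA z₀) * g) = c * f g` with `c * χA (ζA z₀) ≠ 1`), the bi-torus orbital integral vanishes
identically in `γ` — the `[a + p = 0]` factor of memo §2g (5). -/
theorem biTorusOrbital_eq_zero (ρA : TA →* G) (ρB : TB →* G) (χA : TA →* ℂ) (χB : TB →* ℂ) (ζA : ZA →* TA)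
    (f : G → ℂ) (z₀ : ZA) (c : ℂ) (hc : c * χA (ζA z₀) ≠ 1) (hf0 : ∀ g, f (ρA (ζA z₀) * g) = c * f g) (γ : G) :
    biTorusOrbital μA μB ρA ρB χA χB f γ = 0 := by
  rw [biTorusOrbital_def]
  refine integral_eq_zero_of_forall_mul_left_eq_mul (μA.prod μB) _ (ζA z₀, 1) (c * χA (ζA z₀)) hc fun p => ?_
  simp only [Prod.fst_mul, Prod.snd_mul, one_mul, map_mul, mul_assoc (ρA (ζA z₀)), hf0]
  ring

end BiTorus

end Summit.Ventures.HodgeRepro2.Tier7.Line3.CentralCharacter
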